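import Literature.Topology.FourManifolds.LinkKhComplex
import HarnessLib

/-!
# Birth and death: the unit and counit chain maps (link tower, layer T4a)

Fourth layer of the link tower `LinkGaussDiagrams` (D1: `LinkGaussDiagram`,
`Arc = Fin (2n) ⊕ Fin free`, the Morse moves `birth`, `death`, `saddle`) → `LinkKhResolutions`
(D2a: `State`, `stateGraph`, `StateCircle`, `circleOf`, `IsMergeAt`, `IsSplitAt`,
`circleOf_inr_eq_iff`, `stateCircleEquiv`) → `LinkKhComplex` (D2b: `EnhancedState`, `homDegree`,
`qDegree`, `incidence`, `degStates`, `khovanovD`, `leeD`, `leeCycles`, `qMin`): the chain maps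
induced on the Khovanov complex over `A = R[X]/(X² - hX - t)` (hence on Lee's complex,
`(R, h, t) = (ℚ, 0, 1)`) by the two simplest elementary cobordisms of a movie, the **birth**
(cup, index `0`) and the **death** (cap, index `2`) of a crossingless circle: the unit
`ι : C(L) → C(L.birth)`, `x ↦ x ⊗ 1`, and the counit `ε : C(L.birth) → C(L)`, `ε(1) = 0`,
`ε(X) = 1`, on the tensor factor `A` of the new circle (Rasmussen (2010), §4, eq. (4.1);
Khovanov (2000), §6).

## Contents

* `birth` bookkeeping: `L.birth` has the crossings of `L` (`n`, `overPos`, `underPos`, `sign`,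
  `next` unchanged, all `rfl`), so `L.birth.State = L.State`; its arcs are the old ones
  (`embedArc`, old free circle `j ↦ j.castSucc`) and the new free circle
  `newArc = inr (Fin.last free)`, an isolated vertex of every state graph
  (`circleOf_birth_embedArc`, `circleOf_birth_newArc_eq_iff`,
  `stateCircleBirthEquiv : L.StateCircle σ ⊕ Unit ≃ L.birth.StateCircle σ`), so merges and
  splits are those of `L` (`isMergeAt_birth_iff`, `isSplitAt_birth_iff`).
* enhanced states: `EnhancedState.restrict` (forget the label of the new circle) and
  `EnhancedState.extend s b` (label it `b`), a bijection
  `L.birth.EnhancedState ≃ L.EnhancedState × Bool` preserving `homDegree` (`rfl`), with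
  `qDegree (s.extend b) = qDegree s + (if b then -1 else 1)` (`qDegree_extend`; label `false`
  is Khovanov's `1 = v₊`, `true` is `X = v₋`, as in `qDegree_unknots`).
* **incidence locality** (`incidence_birth`): `⟨d s', t'⟩_{L.birth} = ⟨d s'|, t'|⟩_L` if `s'`,
  `t'` carry the same label on the new circle and `0` otherwise — a crossing change never merges
  or splits the new free circle.
* the chain maps `birthMap R i : (L.degStates i → R) →ₗ[R] (L.birth.degStates i → R)` (unit)
  and `deathMap R i : (L.birth.degStates i → R) →ₗ[R] (L.degStates i → R)` (counit), the
  **chain map identities** `khovanovD_comp_birthMap`, `khovanovD_comp_deathMap` (for every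
  `i i'`, every `(R, h, t)`), their Lee specialisations and the induced maps on `leeCycles`, on
  degree-zero boundaries and on `LeeHomologyZero` (`leeHomologyZeroBirth`,
  `leeHomologyZeroDeath`).
* **filtration**: both maps are filtered of `q`-degree `+1` (`qDegree_eq_of_birthMap_ne_zero`,
  `le_qMin_birthMap`, `qDegree_eq_of_deathMap_ne_zero`, `le_qMin_deathMap`, in the shape of the
  knot tower's `le_qMin_mergeMap` / `le_qMin_splitMap_apply`).
* sanity: `deathMap ∘ birthMap = 0` (`ε(1) = 0`), `deathMap ∘ newCircleX ∘ birthMap = id`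
  (`ε(X) = 1`), the values on basis vectors (`birthMap_single`,
  `deathMap_single_extendD_true/false`), and the unlinks (`(unknots k).birth = unknots (k + 1)`
  is `rfl`; `extend (oneStateUnknots k) false = oneStateUnknots (k + 1)`).

## Typing of the death map

D1's `death` removes the LAST free circle (`free ↦ free - 1`), and `L.death.birth = L` holds
only propositionally, for `0 < L.free` (`birth_death`; `L.birth.death = L` is `rfl`,
`death_birth`). The counit is therefore typed on `L.birth → L`, where no cast enters the
chain-map identities; the death of the last free circle of `L` typed with D1's `death`,
`deathMap' : C(L) → C(L.death)` (`0 < L.free`), is its transport along `birth_death`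
(`deathMapOfEq`, chain map by `subst`), and the death of another free circle is the same map
after relabelling the free circles (a symmetry of all the data).

## References

* J. Rasmussen, *Khovanov homology and the slice genus*, Invent. Math. 182 (2010) 419–447, §4,
  eq. (4.1) (the maps `ι`, `ε` of births and deaths; filtered degree `1`).
  [cite: Rasmussen2010, §4 (4.1)]
* M. Khovanov, *A categorification of the Jones polynomial*, Duke Math. J. 101 (2000) 359–426,
  §6 (maps induced by cobordisms; §6.2 cup and cap). [cite: Khovanov2000, §6]
* Mathlib: `Fin.lastCases`, `Fin.eq_castSucc_or_eq_last`, `SimpleGraph.ConnectedComponent.map`,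
  `SimpleGraph.ConnectedComponent.lift`, `Equiv.sum_comp`, `Fintype.sum_sum_type`,
  `Fintype.sum_prod_type`, `Submodule.mapQ`, `LinearMap.restrict`.
-/

open Function Set

noncomputable section

namespace Literature.Topology.FourManifolds

namespace LinkGaussDiagram

variable (L : LinkGaussDiagram)

/-! ## `birth` and `death` bookkeeping -/

/-- A birth adds one free circle (definitionally). [cite: Rasmussen2010, §4 (4.1)] -/
theorem birth_free : L.birth.free = L.free + 1 := rfl

/-- A birth keeps the over-passages (definitionally). [folklore] -/
@[simp] theorem birth_overPos (i : Fin L.n) : L.birth.overPos i = L.overPos i := rfl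

/-- A birth keeps `n₊` (definitionally). [folklore] -/
theorem nPlus_birth : L.birth.nPlus = L.nPlus := rfl

/-- A birth keeps `n₋` (definitionally). [folklore] -/
theorem nMinus_birth : L.birth.nMinus = L.nMinus := rfl

/-- **Death after birth is the identity** (definitionally: `free + 1 - 1 = free`).
Rasmussen (2010), §4.1. [cite: Rasmussen2010, §4 (4.1)] -/
theorem death_birth : L.birth.death = L := rfl

/-- **Birth after death is the identity** when there is a free circle to kill (`0 < free`;
this is why the counit is typed on `L.birth → L`). [cite: Rasmussen2010, §4 (4.1)] -/
theorem birth_death (h : 0 < L.free) : L.death.birth = L := by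
  obtain ⟨n, f, o, u, s, b, nx⟩ := L
  show (⟨n, f - 1 + 1, o, u, s, b, nx⟩ : LinkGaussDiagram) = ⟨n, f, o, u, s, b, nx⟩
  rw [Nat.sub_add_cancel h]

/-! ## Arcs of `L.birth`: the old arcs and the new free circle -/

/-- The arcs of `L` inside the arcs of `L.birth`: arcs through marked points are unchanged, the
old free circle `j` becomes `j.castSucc`. [folklore] -/
def embedArc : L.Arc → L.birth.Arc := Sum.map id Fin.castSucc

/-- The **new free circle** born by `L.birth`: the last free circle `inr (Fin.last free)`.
[cite: Rasmussen2010, §4 (4.1)] -/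
def newArc : L.birth.Arc := .inr (Fin.last L.free)

/-- `embedArc` on an arc through marked points. [folklore] -/
@[simp] theorem embedArc_inl (q : Fin (2 * L.n)) : L.embedArc (.inl q) = .inl q := rfl

/-- `embedArc` on an old free circle. [folklore] -/
@[simp] theorem embedArc_inr (j : Fin L.free) : L.embedArc (.inr j) = .inr j.castSucc := rfl

/-- An old arc is not the new free circle. [folklore] -/
theorem embedArc_ne_newArc (a : L.Arc) : L.embedArc a ≠ L.newArc := by
  rcases a with q | j
  · exact Sum.inl_ne_inr
  · exact fun h ↦ (Fin.castSucc_lt_last j).ne (Sum.inr_injective h)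

/-- **The arcs of `L.birth` are the old arcs and the new free circle.** [folklore] -/
theorem birth_arc_cases (c : L.birth.Arc) : (∃ a, c = L.embedArc a) ∨ c = L.newArc := by
  rcases c with q | j
  · exact Or.inl ⟨.inl q, rfl⟩
  · rcases j.eq_castSucc_or_eq_last with ⟨j', rfl⟩ | rfl
    · exact Or.inl ⟨.inr j', rfl⟩
    · exact Or.inr rfl

/-- The arc of `L.birth` entering a marked point is the old one (definitionally). [folklore] -/
theorem birth_arcIn (p : Fin (2 * L.n)) : L.birth.arcIn p = L.embedArc (L.arcIn p) := rfl

/-- The arc of `L.birth` leaving a marked point is the old one (definitionally). [folklore] -/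
theorem birth_arcOut (p : Fin (2 * L.n)) : L.birth.arcOut p = L.embedArc (L.arcOut p) := rfl

/-- **Extension of a labelling** of the arcs of `L` to the arcs of `L.birth` by the label `b` on
the new free circle. [folklore] -/
def extendLabel (f : L.Arc → Bool) (b : Bool) : L.birth.Arc → Bool
  | .inl q => f (.inl q)
  | .inr j => Fin.lastCases b (fun j' ↦ f (.inr j')) j

/-- The extended labelling restricts to the given one. [folklore] -/
@[simp] theorem extendLabel_embedArc (f : L.Arc → Bool) (b : Bool) (a : L.Arc) :
    L.extendLabel f b (L.embedArc a) = f a := by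
  rcases a with q | j
  · rfl
  · simp only [embedArc_inr, extendLabel]
    exact Fin.lastCases_castSucc (i := j)

/-- The extended labelling gives the new free circle the prescribed label. [folklore] -/
@[simp] theorem extendLabel_newArc (f : L.Arc → Bool) (b : Bool) :
    L.extendLabel f b L.newArc = b := by
  simp only [newArc, extendLabel]
  exact Fin.lastCases_last

/-- A labelling of `L.birth.Arc` is the extension of its restriction. [folklore] -/
theorem extendLabel_comp_embedArc (g : L.birth.Arc → Bool) :
    L.extendLabel (g ∘ L.embedArc) (g L.newArc) = g := by
  funext c
  rcases L.birth_arc_cases c with ⟨a, rfl⟩ | rfl <;> simp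

/-! ## State circles of `L.birth`: the old ones and the new free circle -/

/-- **The state graph of `L.birth` restricted to the old arcs is the state graph of `L`** (the
reconnection relation reads only the chords and `next`). Khovanov (2000), §4.2 (a crossingless
component is untouched by every resolution). [cite: Khovanov2000, §6] -/
theorem stateGraph_birth_adj_embedArc (σ : L.State) (a b : L.Arc) :
    (L.birth.stateGraph σ).Adj (L.embedArc a) (L.embedArc b) ↔ (L.stateGraph σ).Adj a b := by
  rcases a with q | j
  · rcases b with r | j'
    · rw [embedArc_inl, embedArc_inl, stateGraph_adj_inl_inl, stateGraph_adj_inl_inl]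
      exact Iff.rfl
    · simp only [embedArc_inl, embedArc_inr, L.not_stateGraph_adj_inr_right,
        L.birth.not_stateGraph_adj_inr_right]
  · simp only [embedArc_inr, L.not_stateGraph_adj_inr_left, L.birth.not_stateGraph_adj_inr_left]

/-- The new free circle is isolated in every state graph of `L.birth` (left slot). [folklore] -/
theorem not_stateGraph_birth_adj_newArc_left (σ : L.State) (c : L.birth.Arc) :
    ¬ (L.birth.stateGraph σ).Adj L.newArc c :=
  L.birth.not_stateGraph_adj_inr_left σ _ c

/-- The new free circle is isolated in every state graph of `L.birth` (right slot). [folklore] -/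
theorem not_stateGraph_birth_adj_newArc_right (σ : L.State) (c : L.birth.Arc) :
    ¬ (L.birth.stateGraph σ).Adj c L.newArc :=
  L.birth.not_stateGraph_adj_inr_right σ c _

/-- Adjacency in a state graph of `L.birth`: between old arcs, as in `L`. [folklore] -/
theorem stateGraph_birth_adj_iff (σ : L.State) (c c' : L.birth.Arc) :
    (L.birth.stateGraph σ).Adj c c' ↔
      ∃ a b, c = L.embedArc a ∧ c' = L.embedArc b ∧ (L.stateGraph σ).Adj a b := by
  constructor
  · intro h
    rcases L.birth_arc_cases c with ⟨a, rfl⟩ | rfl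
    · rcases L.birth_arc_cases c' with ⟨b, rfl⟩ | rfl
      · exact ⟨a, b, rfl, rfl, (L.stateGraph_birth_adj_embedArc σ a b).1 h⟩
      · exact absurd h (L.not_stateGraph_birth_adj_newArc_right σ _)
    · exact absurd h (L.not_stateGraph_birth_adj_newArc_left σ _)
  · rintro ⟨a, b, rfl, rfl, h⟩
    exact (L.stateGraph_birth_adj_embedArc σ a b).2 h

/-- The inclusion of the state graph of `L` into that of `L.birth`, as a graph hom. [folklore] -/
def embedHom (σ : L.State) : L.stateGraph σ →g L.birth.stateGraph σ where
  toFun := L.embedArc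
  map_rel' h := (L.stateGraph_birth_adj_embedArc σ _ _).2 h

/-- **Old state circles do not change under a birth**: two old arcs lie on the same state circle
of `L.birth` iff they lie on the same state circle of `L` (same chord part, free circles are
singletons; `circleOf_eq_circleOf_iff` of D2a). Khovanov (2000), §4.2. [cite: Khovanov2000, §6] -/
theorem circleOf_birth_embedArc (σ : L.State) (a b : L.Arc) :
    L.birth.circleOf σ (L.embedArc a) = L.birth.circleOf σ (L.embedArc b) ↔
      L.circleOf σ a = L.circleOf σ b := by
  rw [circleOf_eq_circleOf_iff, circleOf_eq_circleOf_iff]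
  rcases a with q | j
  · rcases b with r | j'
    · simp only [embedArc_inl, circlePart, Sum.map_inl, Sum.inl.injEq]
      exact Iff.rfl
    · simp [circlePart]
  · rcases b with r | j'
    · simp [circlePart]
    · simp only [embedArc_inr, circlePart, Sum.map_inr, id_eq, Sum.inr.injEq]
      exact (Fin.castSucc_injective _).eq_iff

/-- **The new free circle is a state circle on its own** in every state of `L.birth`.
Khovanov (2000), §4.2. [cite: Khovanov2000, §6] -/
theorem circleOf_birth_newArc_eq_iff (σ : L.State) (c : L.birth.Arc) :
    L.birth.circleOf σ L.newArc = L.birth.circleOf σ c ↔ c = L.newArc :=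
  L.birth.circleOf_inr_eq_iff σ _ c

/-- An old arc does not lie on the new free circle. [folklore] -/
theorem circleOf_birth_embedArc_ne_newArc (σ : L.State) (a : L.Arc) :
    L.birth.circleOf σ (L.embedArc a) ≠ L.birth.circleOf σ L.newArc := fun h ↦
  L.embedArc_ne_newArc a ((L.circleOf_birth_newArc_eq_iff σ _).1 h.symm)

/-- The state circle of an old arc, pushed into `L.birth` along `embedHom`. [folklore] -/
theorem map_embedHom_circleOf (σ : L.State) (a : L.Arc) :
    (L.circleOf σ a).map (L.embedHom σ) = L.birth.circleOf σ (L.embedArc a) :=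
  SimpleGraph.ConnectedComponent.map_mk _ _

/-- **Merges do not see the new free circle**: `σ → σ[i ↦ 1]` is a merge for `L.birth` iff it
is one for `L`. Khovanov (2000), §6. [cite: Khovanov2000, §6] -/
theorem isMergeAt_birth_iff (σ : L.birth.State) (i : Fin L.n) :
    L.birth.IsMergeAt σ i ↔ L.IsMergeAt σ i :=
  Iff.and Iff.rfl
    (L.circleOf_birth_embedArc σ (L.arcIn (L.overPos i)) (L.arcOut (L.overPos i))).not

/-- **Splits do not see the new free circle**: `σ → σ[i ↦ 1]` is a split for `L.birth` iff it
is one for `L`. Khovanov (2000), §6. [cite: Khovanov2000, §6] -/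
theorem isSplitAt_birth_iff (σ : L.birth.State) (i : Fin L.n) :
    L.birth.IsSplitAt σ i ↔ L.IsSplitAt σ i :=
  Iff.and Iff.rfl
    (L.circleOf_birth_embedArc (Function.update σ i true) (L.arcIn (L.overPos i))
      (L.arcOut (L.overPos i))).not

/-- The "circle part" of an arc of `L.birth` read in `L`: the state circle of an old arc, or the
extra point for the new free circle. [folklore] -/
def unembedCircle (σ : L.State) : L.birth.Arc → L.StateCircle σ ⊕ Unit
  | .inl q => .inl (L.circleOf σ (.inl q))
  | .inr j => Fin.lastCases (.inr ()) (fun j' ↦ .inl (L.circleOf σ (.inr j'))) j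

/-- `unembedCircle` on an old arc is its state circle. [folklore] -/
@[simp] theorem unembedCircle_embedArc (σ : L.State) (a : L.Arc) :
    L.unembedCircle σ (L.embedArc a) = .inl (L.circleOf σ a) := by
  rcases a with q | j
  · rfl
  · simp only [embedArc_inr, unembedCircle]
    exact Fin.lastCases_castSucc (i := j)

/-- `unembedCircle` on the new free circle is the extra point. [folklore] -/
@[simp] theorem unembedCircle_newArc (σ : L.State) : L.unembedCircle σ L.newArc = .inr () := by
  simp only [newArc, unembedCircle]
  exact Fin.lastCases_last

/-- Arcs of `L.birth` on the same state circle have the same `unembedCircle` (adjacent arcs are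
old arcs adjacent in `L`). [folklore] -/
theorem unembedCircle_eq_of_reachable (σ : L.State) {c c' : L.birth.Arc}
    (h : (L.birth.stateGraph σ).Reachable c c') : L.unembedCircle σ c = L.unembedCircle σ c' := by
  obtain ⟨w⟩ := h
  induction w with
  | nil => rfl
  | cons hadj _ ih =>
    obtain ⟨a, b, rfl, rfl, hab⟩ := (L.stateGraph_birth_adj_iff σ _ _).1 hadj
    rw [← ih, unembedCircle_embedArc, unembedCircle_embedArc]
    exact congrArg Sum.inl (SimpleGraph.ConnectedComponent.sound hab.reachable)

/-- **State circles of `L.birth` = state circles of `L` ⊔ the new free circle**, as an explicit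
bijection (old circle `↦` its image under `embedHom`, the extra point `↦` the circle of `newArc`);
in particular `circleCount` goes up by one (`circleCount_birth` of D2a). Khovanov (2000), §4.2,
§6.2. [cite: Khovanov2000, §6] -/
def stateCircleBirthEquiv (σ : L.State) : L.StateCircle σ ⊕ Unit ≃ L.birth.StateCircle σ where
  toFun := Sum.elim (SimpleGraph.ConnectedComponent.map (L.embedHom σ))
    fun _ ↦ L.birth.circleOf σ L.newArc
  invFun := SimpleGraph.ConnectedComponent.lift (L.unembedCircle σ)
    fun _ _ p _ ↦ L.unembedCircle_eq_of_reachable σ p.reachable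
  left_inv x := by
    rcases x with c | u
    · induction c using SimpleGraph.ConnectedComponent.ind with
      | h a => exact L.unembedCircle_embedArc σ a
    · exact L.unembedCircle_newArc σ
  right_inv c := by
    induction c using SimpleGraph.ConnectedComponent.ind with
    | h c =>
      rcases L.birth_arc_cases c with ⟨a, rfl⟩ | rfl
      · show Sum.elim _ _ (L.unembedCircle σ (L.embedArc a)) = L.birth.circleOf σ (L.embedArc a)
        rw [unembedCircle_embedArc, Sum.elim_inl, map_embedHom_circleOf]
      · show Sum.elim _ _ (L.unembedCircle σ L.newArc) = L.birth.circleOf σ L.newArc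
        rw [unembedCircle_newArc, Sum.elim_inr]

/-- `stateCircleBirthEquiv` on an old state circle. [folklore] -/
@[simp] theorem stateCircleBirthEquiv_inl (σ : L.State) (a : L.Arc) :
    L.stateCircleBirthEquiv σ (.inl (L.circleOf σ a)) = L.birth.circleOf σ (L.embedArc a) :=
  L.map_embedHom_circleOf σ a

/-- `stateCircleBirthEquiv` on the extra point. [folklore] -/
@[simp] theorem stateCircleBirthEquiv_inr (σ : L.State) (u : Unit) :
    L.stateCircleBirthEquiv σ (.inr u) = L.birth.circleOf σ L.newArc := rfl

/-! ## Enhanced states: `restrict` and `extend` -/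

variable {L}

/-- **Restriction** of an enhanced state of `L.birth` to `L`: same state, forget the label of the
new free circle (generators of `C(L ⊔ ◯) = C(L) ⊗ A`). [cite: Rasmussen2010, §4 (4.1)] -/
def EnhancedState.restrict (s' : L.birth.EnhancedState) : L.EnhancedState where
  state := s'.state
  label := s'.label ∘ L.embedArc
  label_eq a b hab := s'.label_eq _ _ ((L.stateGraph_birth_adj_embedArc _ a b).2 hab)

/-- **Extension** of an enhanced state of `L` to `L.birth` by a label `b` on the new free circle
(`false ↔ 1`, `true ↔ X`). Rasmussen (2010), §4.1. [cite: Rasmussen2010, §4 (4.1)] -/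
def EnhancedState.extend (s : L.EnhancedState) (b : Bool) : L.birth.EnhancedState where
  state := s.state
  label := L.extendLabel s.label b
  label_eq c c' hcc' := by
    obtain ⟨a, a', rfl, rfl, hab⟩ := (L.stateGraph_birth_adj_iff _ c c').1 hcc'
    rw [extendLabel_embedArc, extendLabel_embedArc]
    exact s.label_eq a a' hab

/-- Restriction keeps the state. [folklore] -/
@[simp] theorem EnhancedState.restrict_state (s' : L.birth.EnhancedState) :
    s'.restrict.state = s'.state := rfl

/-- Restriction reads the labels of the old arcs. [folklore] -/
@[simp] theorem EnhancedState.restrict_label (s' : L.birth.EnhancedState) (a : L.Arc) :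
    s'.restrict.label a = s'.label (L.embedArc a) := rfl

/-- Extension keeps the state. [folklore] -/
@[simp] theorem EnhancedState.extend_state (s : L.EnhancedState) (b : Bool) :
    (s.extend b).state = s.state := rfl

/-- Extension keeps the labels of the old arcs. [folklore] -/
@[simp] theorem EnhancedState.extend_label_embedArc (s : L.EnhancedState) (b : Bool)
    (a : L.Arc) : (s.extend b).label (L.embedArc a) = s.label a :=
  L.extendLabel_embedArc _ _ a

/-- Extension labels the new free circle as prescribed. [folklore] -/
@[simp] theorem EnhancedState.extend_label_newArc (s : L.EnhancedState) (b : Bool) :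
    (s.extend b).label L.newArc = b :=
  L.extendLabel_newArc _ _

/-- `restrict ∘ extend = id`. [folklore] -/
@[simp] theorem EnhancedState.restrict_extend (s : L.EnhancedState) (b : Bool) :
    (s.extend b).restrict = s :=
  EnhancedState.ext' rfl (funext fun a ↦ L.extendLabel_embedArc _ _ a)

/-- An enhanced state of `L.birth` is the extension of its restriction. [folklore] -/
@[simp] theorem EnhancedState.extend_restrict (s' : L.birth.EnhancedState) :
    s'.restrict.extend (s'.label L.newArc) = s' :=
  EnhancedState.ext' rfl (L.extendLabel_comp_embedArc s'.label)

/-- Two extensions agree iff the states and both labels agree. [folklore] -/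
theorem EnhancedState.extend_inj {s u : L.EnhancedState} {b b' : Bool} :
    s.extend b = u.extend b' ↔ s = u ∧ b = b' := by
  constructor
  · intro h
    exact ⟨by rw [← s.restrict_extend b, h, restrict_extend],
      by rw [← s.extend_label_newArc b, h, extend_label_newArc]⟩
  · rintro ⟨rfl, rfl⟩
    rfl

variable (L) in
/-- **Enhanced states of `L.birth` = enhanced states of `L` × label of the new circle**
(`C(L ⊔ ◯) = C(L) ⊗ A` on generators). Khovanov (2000), §6.2. [cite: Rasmussen2010, §4 (4.1)] -/
def enhancedStateBirthEquiv : L.birth.EnhancedState ≃ L.EnhancedState × Bool where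
  toFun s' := (s'.restrict, s'.label L.newArc)
  invFun p := p.1.extend p.2
  left_inv s' := s'.extend_restrict
  right_inv p := Prod.ext (p.1.restrict_extend p.2) (p.1.extend_label_newArc p.2)

/-- **Restriction preserves the homological degree** (definitional).
[cite: Rasmussen2010, §4 (4.1)] -/
theorem homDegree_restrict (s' : L.birth.EnhancedState) :
    homDegree s'.restrict = homDegree s' :=
  rfl

/-- **Extension preserves the homological degree** (definitional).
[cite: Rasmussen2010, §4 (4.1)] -/
theorem homDegree_extend (s : L.EnhancedState) (b : Bool) :
    homDegree (s.extend b) = homDegree s :=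
  rfl

/-- The weight of a state read in `L.birth` is its weight (definitional). [folklore] -/
theorem weight_birth (σ : L.birth.State) :
    State.weight (L := L.birth) σ = State.weight (L := L) σ := rfl

/-! ## Quantum degrees: the new circle contributes `±1` -/

/-- The circles of `L.birth` carrying a given label in an extended enhanced state: the old ones,
plus the new free circle when its label is the given one. [folklore] -/
theorem card_filter_circle_extend (s : L.EnhancedState) (b v : Bool) :
    (Finset.univ.filter fun c : L.birth.StateCircle (s.extend b).state ↦
        ∃ a, L.birth.circleOf (s.extend b).state a = c ∧ (s.extend b).label a = v).card =
      (Finset.univ.filter fun c : L.StateCircle s.state ↦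
        ∃ a, L.circleOf s.state a = c ∧ s.label a = v).card + if b = v then 1 else 0 := by
  have hiff₁ : ∀ c : L.StateCircle s.state,
      (∃ a, L.birth.circleOf (s.extend b).state a =
          L.stateCircleBirthEquiv (s.extend b).state (.inl c) ∧ (s.extend b).label a = v) ↔
        ∃ a, L.circleOf s.state a = c ∧ s.label a = v := by
    intro c
    constructor
    · rintro ⟨c', hc', hv⟩
      rcases L.birth_arc_cases c' with ⟨a, rfl⟩ | rfl
      · refine ⟨a, Sum.inl_injective ((L.stateCircleBirthEquiv (s.extend b).state).injective
          ((L.stateCircleBirthEquiv_inl (s.extend b).state a).trans hc')), ?_⟩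
        simpa using hv
      · exact absurd ((L.stateCircleBirthEquiv (s.extend b).state).injective
          ((L.stateCircleBirthEquiv_inr (s.extend b).state ()).trans hc')) Sum.inr_ne_inl
    · rintro ⟨a, rfl, hv⟩
      exact ⟨L.embedArc a, (L.stateCircleBirthEquiv_inl (s.extend b).state a).symm,
        by simpa using hv⟩
  have hiff₂ : (∃ a, L.birth.circleOf (s.extend b).state a =
      L.birth.circleOf (s.extend b).state L.newArc ∧ (s.extend b).label a = v) ↔ b = v := by
    constructor
    · rintro ⟨c, hc, hv⟩
      obtain rfl : c = L.newArc := (L.circleOf_birth_newArc_eq_iff _ c).1 hc.symm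
      simpa using hv
    · rintro rfl
      exact ⟨L.newArc, rfl, s.extend_label_newArc b⟩
  rw [Finset.card_filter, Finset.card_filter,
    ← (L.stateCircleBirthEquiv (s.extend b).state).sum_comp, Fintype.sum_sum_type]
  simp only [Finset.univ_unique, Finset.sum_singleton, stateCircleBirthEquiv_inr]
  congr 1
  · exact Finset.sum_congr rfl fun c _ ↦ if_congr (hiff₁ c) rfl rfl
  · exact if_congr hiff₂ rfl rfl

/-- **The quantum degree of an extension**: the new circle contributes `+1` with the label
`1 = v₊` (`false`) and `-1` with the label `X = v₋` (`true`) (conventions of `qDegree_unknots`;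
Bar-Natan (2002), §3.2). [cite: Rasmussen2010, §4 (4.1)] -/
theorem qDegree_extend (s : L.EnhancedState) (b : Bool) :
    qDegree (s.extend b) = qDegree s + if b then -1 else 1 := by
  unfold qDegree
  rw [card_filter_circle_extend s b false, card_filter_circle_extend s b true, nPlus_birth,
    nMinus_birth, weight_birth]
  dsimp only [EnhancedState.extend_state]
  cases b <;> simp <;> ring

/-- **The quantum degree of an enhanced state of `L.birth`** is that of its restriction plus the
contribution `±1` of the new circle. [cite: Rasmussen2010, §4 (4.1)] -/
theorem qDegree_eq_qDegree_restrict (s' : L.birth.EnhancedState) :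
    qDegree s' = qDegree s'.restrict + if s'.label L.newArc then -1 else 1 := by
  conv_lhs => rw [← s'.extend_restrict]
  exact qDegree_extend _ _

/-! ## Incidence locality -/

variable (L)

/-- The agreement clause of the incidence number ("labels agree off the circle of an old arc")
for `L.birth`, read in `L`: agreement off that circle among the old arcs, and agreement on the new
free circle (which is never that circle). [folklore] -/
theorem forall_arc_birth_iff (τ : L.birth.State) (a : L.Arc) (f g : L.birth.Arc → Bool) :
    (∀ c, L.birth.circleOf τ c ≠ L.birth.circleOf τ (L.embedArc a) → f c = g c) ↔
      (∀ c, L.circleOf τ c ≠ L.circleOf τ a → f (L.embedArc c) = g (L.embedArc c)) ∧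
        f L.newArc = g L.newArc := by
  constructor
  · intro h
    exact ⟨fun c hc ↦ h _ fun h' ↦ hc ((L.circleOf_birth_embedArc τ c a).1 h'),
      h _ (L.circleOf_birth_embedArc_ne_newArc τ a).symm⟩
  · rintro ⟨h, hn⟩ c hc
    rcases L.birth_arc_cases c with ⟨c, rfl⟩ | rfl
    · exact h c fun h' ↦ hc ((L.circleOf_birth_embedArc τ c a).2 h')
    · exact hn

section Ring

variable (R : Type) [CommRing R]

/-- **Incidence locality (key lemma).** The incidence number `⟨d s', t'⟩` of `L.birth` over
`A = R[X]/(X² - hX - t)` is `⟨d s'|, t'|⟩` of `L` (restrictions) when `s'`, `t'` carry the same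
label on the new free circle, and `0` otherwise: the flipped chord, the merge / split / neither
trichotomy, the local strands and the Koszul sign are those of `L` (`isMergeAt_birth_iff`,
`isSplitAt_birth_iff`), and the agreement clause off the changed circle contains the new circle
(`forall_arc_birth_iff`): `d_{L ⊔ ◯} = d_L ⊗ id_A`. Khovanov (2000), §6.2.
[cite: Khovanov2000, §6] -/
theorem incidence_birth (h t : R) (s' t' : L.birth.EnhancedState) :
    L.birth.incidence R h t s' t' =
      if s'.label L.newArc = t'.label L.newArc then L.incidence R h t s'.restrict t'.restrict
      else 0 := by
  by_cases hex : ∃ i : Fin L.n, s'.restrict.state i = false ∧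
      t'.restrict.state = Function.update s'.restrict.state i true
  · obtain ⟨i, hi, ht'⟩ := hex
    rw [incidence_of_flip R h t (L := L.birth) (s := s') (s' := t') (i := i) hi ht',
      incidence_of_flip R h t hi ht']
    have ha : L.birth.arcIn (L.birth.overPos i) = L.embedArc (L.arcIn (L.overPos i)) := rfl
    have hb : L.birth.arcOut (L.birth.overPos i) = L.embedArc (L.arcOut (L.overPos i)) := rfl
    simp only [ha, hb, isMergeAt_birth_iff, isSplitAt_birth_iff, forall_arc_birth_iff,
      EnhancedState.restrict_state, EnhancedState.restrict_label]
    by_cases hP : s'.label L.newArc = t'.label L.newArc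
    · rw [if_pos hP]
      simp only [hP, and_true]
      split_ifs <;> rfl
    · rw [if_neg hP]
      have hP' : ¬ t'.label L.newArc = s'.label L.newArc := fun h' ↦ hP h'.symm
      simp only [hP', and_false, if_false, ite_self]
  · rw [incidence_of_not_flip R h t (L := L.birth) (s := s') (s' := t') hex,
      incidence_of_not_flip R h t hex, ite_self]

/-- Incidence numbers of `L.birth` between extensions: those of `L` when the new labels agree,
zero otherwise. Khovanov (2000), §6.2. [cite: Khovanov2000, §6] -/
theorem incidence_extend_extend (h t : R) (s u : L.EnhancedState) (b b' : Bool) :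
    L.birth.incidence R h t (s.extend b) (u.extend b') =
      if b = b' then L.incidence R h t s u else 0 := by
  rw [incidence_birth]
  simp

/-! ## Degree pieces and the two chain maps -/

/-- Restriction on the enhanced states of homological degree `i`. [folklore] -/
def restrictD (i : ℤ) (s' : L.birth.degStates i) : L.degStates i := ⟨s'.1.restrict, s'.2⟩

/-- Extension on the enhanced states of homological degree `i`. [folklore] -/
def extendD (i : ℤ) (s : L.degStates i) (b : Bool) : L.birth.degStates i := ⟨s.1.extend b, s.2⟩

/-- `restrictD`, underlying enhanced state. [folklore] -/
@[simp] theorem restrictD_val (i : ℤ) (s' : L.birth.degStates i) :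
    (L.restrictD i s').1 = s'.1.restrict := rfl

/-- `extendD`, underlying enhanced state. [folklore] -/
@[simp] theorem extendD_val (i : ℤ) (s : L.degStates i) (b : Bool) :
    (L.extendD i s b).1 = s.1.extend b := rfl

/-- `restrictD ∘ extendD = id`. [folklore] -/
@[simp] theorem restrictD_extendD (i : ℤ) (s : L.degStates i) (b : Bool) :
    L.restrictD i (L.extendD i s b) = s :=
  Subtype.ext (s.1.restrict_extend b)

/-- A degree-`i` enhanced state of `L.birth` is the extension of its restriction. [folklore] -/
@[simp] theorem extendD_restrictD (i : ℤ) (s' : L.birth.degStates i) :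
    L.extendD i (L.restrictD i s') (s'.1.label L.newArc) = s' :=
  Subtype.ext s'.1.extend_restrict

/-- Two `extendD` agree iff the states and the new labels agree. [folklore] -/
theorem extendD_inj {i : ℤ} {s u : L.degStates i} {b b' : Bool} :
    L.extendD i s b = L.extendD i u b' ↔ s = u ∧ b = b' := by
  rw [Subtype.ext_iff, extendD_val, extendD_val, EnhancedState.extend_inj, ← Subtype.ext_iff]

/-- **Degree pieces of `L.birth` = degree pieces of `L` × label of the new circle.**
[cite: Rasmussen2010, §4 (4.1)] -/
def degStatesBirthEquiv (i : ℤ) : L.birth.degStates i ≃ L.degStates i × Bool where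
  toFun s' := (L.restrictD i s', s'.1.label L.newArc)
  invFun p := L.extendD i p.1 p.2
  left_inv s' := L.extendD_restrictD i s'
  right_inv p := Prod.ext (L.restrictD_extendD i p.1 p.2) (p.1.1.extend_label_newArc p.2)

/-- A sum over the degree-`i` enhanced states of `L.birth` is a sum over those of `L` of the two
extensions. [folklore] -/
theorem sum_degStates_birth {M : Type*} [AddCommMonoid M] (i : ℤ)
    (F : L.birth.degStates i → M) :
    ∑ s', F s' = ∑ s : L.degStates i, (F (L.extendD i s true) + F (L.extendD i s false)) := by
  rw [← (L.degStatesBirthEquiv i).symm.sum_comp, Fintype.sum_prod_type]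
  exact Finset.sum_congr rfl fun s _ ↦ Fintype.sum_bool _

/-- The Khovanov differential of a link diagram, evaluated at an enhanced state. [folklore] -/
theorem khovanovD_eq_sum (K : LinkGaussDiagram) (h t : R) (i i' : ℤ) (f : K.degStates i → R)
    (s' : K.degStates i') :
    K.khovanovD R h t i i' f s' = ∑ s, K.incidence R h t s.1 s'.1 * f s := by
  simp only [khovanovD, Matrix.toLin'_apply, Matrix.mulVec, dotProduct, Matrix.of_apply]

/-- **The birth map (unit)** `ι : Cⁱ(L) → Cⁱ(L.birth)`, `x ↦ x ⊗ 1`: on coefficient functions,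
`(ι f)(s') = f (s'|)` if the new circle of `s'` is labelled `1` (`false`) and `0` otherwise. It
does not depend on `(h, t)`. Rasmussen (2010), §4, eq. (4.1); Khovanov (2000), §6.2 (cup).
[cite: Rasmussen2010, §4 (4.1)] -/
def birthMap (i : ℤ) : (L.degStates i → R) →ₗ[R] (L.birth.degStates i → R) where
  toFun f s' := if s'.1.label L.newArc = false then f (L.restrictD i s') else 0
  map_add' f g := by
    funext s'
    simp only [Pi.add_apply]
    split_ifs <;> simp
  map_smul' c f := by
    funext s'
    simp only [Pi.smul_apply, smul_eq_mul, RingHom.id_apply]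
    split_ifs <;> simp

/-- The birth map, evaluated. [folklore] -/
@[simp] theorem birthMap_apply (i : ℤ) (f : L.degStates i → R) (s' : L.birth.degStates i) :
    L.birthMap R i f s' = if s'.1.label L.newArc = false then f (L.restrictD i s') else 0 :=
  rfl

/-- **The death map (counit)** `ε : Cⁱ(L.birth) → Cⁱ(L)`, `ε(y ⊗ 1) = 0`, `ε(y ⊗ X) = y`: on
coefficient functions, `(ε g)(s) = g (s ⊗ X)`, the coefficient of the extension of `s` by the
label `X` (`true`). It does not depend on `(h, t)`. Rasmussen (2010), §4, eq. (4.1);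
Khovanov (2000), §6.2 (cap). [cite: Rasmussen2010, §4 (4.1)] -/
def deathMap (i : ℤ) : (L.birth.degStates i → R) →ₗ[R] (L.degStates i → R) :=
  LinearMap.funLeft R R fun s ↦ L.extendD i s true

/-- The death map, evaluated. [folklore] -/
@[simp] theorem deathMap_apply (i : ℤ) (g : L.birth.degStates i → R) (s : L.degStates i) :
    L.deathMap R i g s = g (L.extendD i s true) := rfl

/-- **The birth map is a chain map**: `d_{L.birth} ∘ ι = ι ∘ d_L` between any two homological
degrees, for every `(R, h, t)` (by incidence locality). [cite: Rasmussen2010, §4 (4.1)] -/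
theorem khovanovD_comp_birthMap (h t : R) (i i' : ℤ) :
    L.birth.khovanovD R h t i i' ∘ₗ L.birthMap R i =
      L.birthMap R i' ∘ₗ L.khovanovD R h t i i' := by
  refine LinearMap.ext fun f ↦ funext fun t' ↦ ?_
  simp only [LinearMap.coe_comp, Function.comp_apply, khovanovD_eq_sum, birthMap_apply,
    restrictD_val]
  rw [sum_degStates_birth]
  simp only [extendD_val, incidence_birth, EnhancedState.extend_label_newArc,
    EnhancedState.restrict_extend, restrictD_extendD]
  by_cases hc : t'.1.label L.newArc = false <;> simp [hc]

/-- **The death map is a chain map**: `d_L ∘ ε = ε ∘ d_{L.birth}` between any two homological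
degrees, for every `(R, h, t)`. [cite: Rasmussen2010, §4 (4.1)] -/
theorem khovanovD_comp_deathMap (h t : R) (i i' : ℤ) :
    L.khovanovD R h t i i' ∘ₗ L.deathMap R i =
      L.deathMap R i' ∘ₗ L.birth.khovanovD R h t i i' := by
  refine LinearMap.ext fun g ↦ funext fun u ↦ ?_
  simp only [LinearMap.coe_comp, Function.comp_apply, khovanovD_eq_sum, deathMap_apply]
  rw [sum_degStates_birth]
  simp [incidence_extend_extend]

/-! ## Unit and counit identities -/

/-- **`ε ∘ ι = 0`** (`ε(1) = 0`): a sphere split into a cup and a cap evaluates to zero.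
Khovanov (2000), §6.2; Rasmussen (2010), §4.1. [cite: Khovanov2000, §6] -/
theorem deathMap_comp_birthMap (i : ℤ) : L.deathMap R i ∘ₗ L.birthMap R i = 0 := by
  refine LinearMap.ext fun f ↦ funext fun s ↦ ?_
  simp

/-- **Multiplication by `X` on the new circle**, an endomorphism of `Cⁱ(L.birth)`: on generators
`y ⊗ 1 ↦ y ⊗ X`, `y ⊗ X ↦ y ⊗ X² = h (y ⊗ X) + t (y ⊗ 1)`; on coefficient functions
`(X g)(s ⊗ X) = g (s ⊗ 1) + h g (s ⊗ X)`, `(X g)(s ⊗ 1) = t g (s ⊗ X)`. Khovanov (2006), §2;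
Rasmussen (2010), §4.1 (the dotted cylinder). [cite: Khovanov2000, §6] -/
def newCircleX (h t : R) (i : ℤ) :
    (L.birth.degStates i → R) →ₗ[R] (L.birth.degStates i → R) where
  toFun g s' := if s'.1.label L.newArc = true then
      g (L.extendD i (L.restrictD i s') false) + h * g s'
    else t * g (L.extendD i (L.restrictD i s') true)
  map_add' f g := by
    funext s'
    simp only [Pi.add_apply]
    split_ifs <;> ring
  map_smul' c f := by
    funext s'
    simp only [Pi.smul_apply, smul_eq_mul, RingHom.id_apply]
    split_ifs <;> ring

/-- Multiplication by `X` on the new circle, evaluated. [folklore] -/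
@[simp] theorem newCircleX_apply (h t : R) (i : ℤ) (g : L.birth.degStates i → R)
    (s' : L.birth.degStates i) :
    L.newCircleX R h t i g s' = if s'.1.label L.newArc = true then
      g (L.extendD i (L.restrictD i s') false) + h * g s'
      else t * g (L.extendD i (L.restrictD i s') true) := rfl

/-- **`ε ∘ X ∘ ι = id`** (`ε(X) = 1`): a sphere with one dot evaluates to `1`.
Khovanov (2000), §6.2. [cite: Khovanov2000, §6] -/
theorem deathMap_comp_newCircleX_comp_birthMap (h t : R) (i : ℤ) :
    L.deathMap R i ∘ₗ L.newCircleX R h t i ∘ₗ L.birthMap R i = LinearMap.id := by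
  refine LinearMap.ext fun f ↦ funext fun s ↦ ?_
  simp

/-- **The unit on basis vectors**: `ι(s) = s ⊗ 1`. [cite: Rasmussen2010, §4 (4.1)] -/
theorem birthMap_single (i : ℤ) (s : L.degStates i) (c : R) :
    L.birthMap R i (Pi.single s c) = Pi.single (L.extendD i s false) c := by
  funext s'
  obtain ⟨u, b, rfl⟩ : ∃ u b, s' = L.extendD i u b := ⟨_, _, (L.extendD_restrictD i s').symm⟩
  cases b <;> simp [Pi.single_apply, extendD_inj]

/-- **The counit on basis vectors, label `X`**: `ε(s ⊗ X) = s`. [cite: Rasmussen2010, §4 (4.1)] -/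
theorem deathMap_single_extendD_true (i : ℤ) (s : L.degStates i) (c : R) :
    L.deathMap R i (Pi.single (L.extendD i s true) c) = Pi.single s c := by
  funext u
  simp [Pi.single_apply, extendD_inj]

/-- **The counit on basis vectors, label `1`**: `ε(s ⊗ 1) = 0`. [cite: Rasmussen2010, §4 (4.1)] -/
theorem deathMap_single_extendD_false (i : ℤ) (s : L.degStates i) (c : R) :
    L.deathMap R i (Pi.single (L.extendD i s false) c) = 0 := by
  funext u
  simp [extendD_inj]

/-! ## The counit typed with D1's `death` -/

/-- **The counit typed against any presentation `N` of `M.birth`** (e.g. `N = L`, `M = L.death`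
when `0 < L.free`, `birth_death`; `N = unknots (k + 1)`, `M = unknots k`): transport of
`deathMap` along `e : M.birth = N`. [cite: Rasmussen2010, §4 (4.1)] -/
def deathMapOfEq (M N : LinkGaussDiagram) (e : M.birth = N) (i : ℤ) :
    (N.degStates i → R) →ₗ[R] (M.degStates i → R) :=
  e ▸ M.deathMap R i

/-- The transported counit is a chain map. [cite: Rasmussen2010, §4 (4.1)] -/
theorem khovanovD_comp_deathMapOfEq (M N : LinkGaussDiagram) (e : M.birth = N) (h t : R)
    (i i' : ℤ) :
    M.khovanovD R h t i i' ∘ₗ deathMapOfEq R M N e i =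
      deathMapOfEq R M N e i' ∘ₗ N.khovanovD R h t i i' := by
  subst e
  exact M.khovanovD_comp_deathMap R h t i i'

/-- **The death of the last free circle, typed with D1's `death`**: for `0 < L.free`,
`ε : Cⁱ(L) → Cⁱ(L.death)` is `L.death.deathMap` read through `L.death.birth = L`
(`birth_death`). Rasmussen (2010), §4, eq. (4.1). [cite: Rasmussen2010, §4 (4.1)] -/
def deathMap' (hL : 0 < L.free) (i : ℤ) : (L.degStates i → R) →ₗ[R] (L.death.degStates i → R) :=
  deathMapOfEq R L.death L (L.birth_death hL) i

/-- The death of the last free circle is a chain map `C(L) → C(L.death)`.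
[cite: Rasmussen2010, §4 (4.1)] -/
theorem khovanovD_comp_deathMap' (hL : 0 < L.free) (h t : R) (i i' : ℤ) :
    L.death.khovanovD R h t i i' ∘ₗ L.deathMap' R hL i =
      L.deathMap' R hL i' ∘ₗ L.khovanovD R h t i i' :=
  khovanovD_comp_deathMapOfEq R L.death L (L.birth_death hL) h t i i'

end Ring

/-! ## Filtration: both maps are filtered of `q`-degree `+1` -/

section Filtration

variable {L}

/-- A state in the support of `ι f` has its new circle labelled `1`: its quantum degree is that
of its restriction (in the support of `f`) plus one. [cite: Rasmussen2010, §4 (4.1)] -/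
theorem qDegree_eq_of_birthMap_ne_zero {R : Type} [CommRing R] {i : ℤ} {f : L.degStates i → R}
    {s' : L.birth.degStates i} (hs' : L.birthMap R i f s' ≠ 0) :
    f (L.restrictD i s') ≠ 0 ∧ qDegree s'.1 = qDegree s'.1.restrict + 1 := by
  rw [birthMap_apply] at hs'
  split_ifs at hs' with hl
  · exact ⟨hs', by rw [qDegree_eq_qDegree_restrict, hl, if_neg Bool.false_ne_true]⟩
  · exact (hs' rfl).elim

/-- A state `s` in the support of `ε g` has `s ⊗ X` in the support of `g`, of quantum degree
`qDegree s - 1`. [cite: Rasmussen2010, §4 (4.1)] -/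
theorem qDegree_eq_of_deathMap_ne_zero {R : Type} [CommRing R] {i : ℤ}
    {g : L.birth.degStates i → R} {s : L.degStates i} (hs : L.deathMap R i g s ≠ 0) :
    g (L.extendD i s true) ≠ 0 ∧ qDegree s.1 = qDegree (L.extendD i s true).1 + 1 := by
  refine ⟨hs, ?_⟩
  rw [extendD_val, qDegree_extend, if_pos rfl]
  ring

/-- An integer bounds the filtration degree of a degree-zero chain from below iff it bounds the
quantum degrees of the states in its support (knot tower: `coe_le_qMin_iff`). [folklore] -/
theorem coe_le_qMin_iff_qDegree {K : LinkGaussDiagram} {x : K.degStates 0 → ℚ} {m : ℤ} :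
    ((m : WithTop ℤ) : WithBot (WithTop ℤ)) ≤ qMin x ↔ ∀ s, x s ≠ 0 → m ≤ qDegree s.1 := by
  unfold qMin
  rw [le_iInf₂_iff]
  refine forall_congr' fun s ↦ forall_congr' fun _ ↦ ?_
  rw [WithBot.coe_le_coe, WithTop.coe_le_coe]

/-- **The birth map is filtered of degree `+1`** (Lee's theory over `ℚ`): if `m ≤ q(x)` then
`m + 1 ≤ q(ι x)` (shape of the knot tower's `le_qMin_mergeMap`). [cite: Rasmussen2010, §4 (4.1)] -/
theorem le_qMin_birthMap (x : L.degStates 0 → ℚ) {m : ℤ}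
    (hm : ((m : WithTop ℤ) : WithBot (WithTop ℤ)) ≤ qMin x) :
    (((m + 1 : ℤ) : WithTop ℤ) : WithBot (WithTop ℤ)) ≤ qMin (L.birthMap ℚ 0 x) := by
  rw [coe_le_qMin_iff_qDegree] at hm ⊢
  intro s' hs'
  obtain ⟨hf, hq⟩ := qDegree_eq_of_birthMap_ne_zero hs'
  have h1 := hm _ hf
  rw [restrictD_val] at h1
  rw [hq]
  linarith

/-- **The death map is filtered of degree `+1`** (Lee's theory over `ℚ`): if `m ≤ q(y)` then
`m + 1 ≤ q(ε y)`. Rasmussen (2010), §4.1. [cite: Rasmussen2010, §4 (4.1)] -/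
theorem le_qMin_deathMap (y : L.birth.degStates 0 → ℚ) {m : ℤ}
    (hm : ((m : WithTop ℤ) : WithBot (WithTop ℤ)) ≤ qMin y) :
    (((m + 1 : ℤ) : WithTop ℤ) : WithBot (WithTop ℤ)) ≤ qMin (L.deathMap ℚ 0 y) := by
  rw [coe_le_qMin_iff_qDegree] at hm ⊢
  intro s hs
  obtain ⟨hg, hq⟩ := qDegree_eq_of_deathMap_ne_zero hs
  have h1 := hm _ hg
  rw [hq]
  linarith

end Filtration

/-! ## Lee's theory: cycles, boundaries, homology in degree zero -/

section Lee

/-- **Lee's birth map is a chain map** (`(R, h, t) = (ℚ, 0, 1)`). [cite: Rasmussen2010, §4 (4.1)] -/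
theorem leeD_comp_birthMap (i i' : ℤ) :
    L.birth.leeD i i' ∘ₗ L.birthMap ℚ i = L.birthMap ℚ i' ∘ₗ L.leeD i i' :=
  L.khovanovD_comp_birthMap ℚ 0 1 i i'

/-- **Lee's death map is a chain map** (`(R, h, t) = (ℚ, 0, 1)`). [cite: Rasmussen2010, §4 (4.1)] -/
theorem leeD_comp_deathMap (i i' : ℤ) :
    L.leeD i i' ∘ₗ L.deathMap ℚ i = L.deathMap ℚ i' ∘ₗ L.birth.leeD i i' :=
  L.khovanovD_comp_deathMap ℚ 0 1 i i'

/-- The birth map carries degree-zero Lee cycles to cycles. [cite: Rasmussen2010, §4 (4.1)] -/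
theorem birthMap_mem_leeCycles {z : L.degStates 0 → ℚ} (hz : z ∈ L.leeCycles) :
    L.birthMap ℚ 0 z ∈ L.birth.leeCycles := by
  rw [LinearMap.mem_ker] at hz ⊢
  rw [← LinearMap.comp_apply, L.khovanovD_comp_birthMap, LinearMap.comp_apply, hz, map_zero]

/-- The death map carries degree-zero Lee cycles to cycles. [cite: Rasmussen2010, §4 (4.1)] -/
theorem deathMap_mem_leeCycles {z : L.birth.degStates 0 → ℚ} (hz : z ∈ L.birth.leeCycles) :
    L.deathMap ℚ 0 z ∈ L.leeCycles := by
  rw [LinearMap.mem_ker] at hz ⊢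
  rw [← LinearMap.comp_apply, L.khovanovD_comp_deathMap, LinearMap.comp_apply, hz, map_zero]

/-- The birth map preserves degree-zero Lee boundaries. [cite: Rasmussen2010, §4 (4.1)] -/
theorem birthMap_mem_range_leeD {x : L.degStates 0 → ℚ}
    (hx : x ∈ LinearMap.range (L.leeD (0 - 1) 0)) :
    L.birthMap ℚ 0 x ∈ LinearMap.range (L.birth.leeD (0 - 1) 0) := by
  rw [LinearMap.mem_range] at hx ⊢
  obtain ⟨y, rfl⟩ := hx
  exact ⟨L.birthMap ℚ (0 - 1) y, LinearMap.congr_fun (L.khovanovD_comp_birthMap ℚ 0 1 _ _) y⟩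

/-- The death map preserves degree-zero Lee boundaries. [cite: Rasmussen2010, §4 (4.1)] -/
theorem deathMap_mem_range_leeD {x : L.birth.degStates 0 → ℚ}
    (hx : x ∈ LinearMap.range (L.birth.leeD (0 - 1) 0)) :
    L.deathMap ℚ 0 x ∈ LinearMap.range (L.leeD (0 - 1) 0) := by
  rw [LinearMap.mem_range] at hx ⊢
  obtain ⟨y, rfl⟩ := hx
  exact ⟨L.deathMap ℚ (0 - 1) y, LinearMap.congr_fun (L.khovanovD_comp_deathMap ℚ 0 1 _ _) y⟩

/-- **The birth map on degree-zero Lee homology** `Kh'⁰(L) → Kh'⁰(L.birth)`: the map of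
quotients induced by `ι` on cycles, well defined on boundaries. Rasmussen (2010), §4.1 (the map
of an elementary cobordism of index `0`). [cite: Rasmussen2010, §4 (4.1)] -/
def leeHomologyZeroBirth : L.LeeHomologyZero →ₗ[ℚ] L.birth.LeeHomologyZero :=
  Submodule.mapQ _ _ ((L.birthMap ℚ 0).restrict fun z hz ↦ L.birthMap_mem_leeCycles hz) (by
    rintro ⟨z, hz⟩ hzr
    rw [Submodule.mem_comap] at hzr ⊢
    exact L.birthMap_mem_range_leeD hzr)

/-- **The death map on degree-zero Lee homology** `Kh'⁰(L.birth) → Kh'⁰(L)`: the map of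
quotients induced by `ε` on cycles. Rasmussen (2010), §4.1 (the map of an elementary cobordism of
index `2`). [cite: Rasmussen2010, §4 (4.1)] -/
def leeHomologyZeroDeath : L.birth.LeeHomologyZero →ₗ[ℚ] L.LeeHomologyZero :=
  Submodule.mapQ _ _ ((L.deathMap ℚ 0).restrict fun z hz ↦ L.deathMap_mem_leeCycles hz) (by
    rintro ⟨z, hz⟩ hzr
    rw [Submodule.mem_comap] at hzr ⊢
    exact L.deathMap_mem_range_leeD hzr)

/-- The Lee homology birth map on the class of a cycle is the class of its image. [folklore] -/
theorem leeHomologyZeroBirth_mk (z : L.leeCycles) :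
    L.leeHomologyZeroBirth (Submodule.Quotient.mk z) =
      Submodule.Quotient.mk ⟨L.birthMap ℚ 0 z, L.birthMap_mem_leeCycles z.2⟩ :=
  rfl

/-- The Lee homology death map on the class of a cycle is the class of its image. [folklore] -/
theorem leeHomologyZeroDeath_mk (z : L.birth.leeCycles) :
    L.leeHomologyZeroDeath (Submodule.Quotient.mk z) =
      Submodule.Quotient.mk ⟨L.deathMap ℚ 0 z, L.deathMap_mem_leeCycles z.2⟩ :=
  rfl

end Lee

/-! ## Sanity: the unlinks -/

section Unknots

/-- Extending the all-`1` labelling of `unknots k` by the label `1` on the new circle gives the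
all-`1` labelling of `unknots (k + 1) = (unknots k).birth`. [cite: Rasmussen2010, §4 (4.1)] -/
theorem extend_oneStateUnknots (k : ℕ) :
    (oneStateUnknots k).extend false = oneStateUnknots (k + 1) := by
  refine EnhancedState.ext' (funext fun i ↦ i.elim0) (funext fun c ↦ ?_)
  rcases (unknots k).birth_arc_cases c with ⟨a, rfl⟩ | rfl
  · rw [EnhancedState.extend_label_embedArc]
    rfl
  · rw [EnhancedState.extend_label_newArc]
    rfl

/-- **Sanity (`unknots`).** The birth map of the unlink carries the cycle `[all circles 1]` of
`unknots k` (filtration degree `k`, `leeSMax_unknots`) to the cycle `[all circles 1]` of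
`unknots (k + 1)` (filtration degree `k + 1`). Rasmussen (2010), §4.1.
[cite: Rasmussen2010, §4 (4.1)] -/
theorem birthMap_single_oneStateUnknots (R : Type) [CommRing R] (k : ℕ) (c : R) :
    (unknots k).birthMap R 0 (Pi.single ⟨oneStateUnknots k, homDegree_unknots k _⟩ c) =
      Pi.single ⟨oneStateUnknots (k + 1), homDegree_unknots (k + 1) _⟩ c := by
  rw [birthMap_single]
  congr 1
  exact Subtype.ext (extend_oneStateUnknots k)

end Unknots

end LinkGaussDiagram

end Literature.Topology.FourManifolds
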